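import Summits.NavierStokesRegularity.NavierStokesRegularity.Theorems.AdaptedFrequencyConverges.Negative.AdaptedKernel

/-!
# A lower-pinched linear clock admits no adapted Gaussian kernel (triage F1, formal core)

Negative-side support for crux `AdaptedFrequencyConverges` (stmt-NavierStokesRegularity-10493), cdisprove
seat, cycle 2.  Real analysis over the Gaussian calculus of `…Negative.KernelVariances` / `…Negative.AdaptedKernel`.

For the exact linear Navier–Stokes flows `u = d(t) D₀x + ½ω(t) e₀×x` (`D₀ = diag(1,−½,−½)`, stretching
law `ω′ = dω`) of `…Negative.LinearFlow`, an axisymmetric Gaussian `N(0, diag(α,β,β))` solves the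
adjoint equation `∂ₜG + u·∇G + νΔG = 0` exactly when `α′ = 2dα − 2ν` and `β′ = −dβ − 2ν`
(`…Negative.AdaptedKernel`, Part C4 of the crux workfile, read in both directions).  If the adapted
enstrophy `H = ω²` of such a flow were LOWER-PINCHED, `c ≤ (1−t)ω(t)` (`⇔ c² ≤ (1−t)²H`), then along
the flow `(βω)′ = −2νω ≤ −2νc/(1−t)`, so `βω − 2νc·log(1/(1−t))`… precisely
`F = βω − 2νc·log(1−t)` is non-increasing and `βω ≤ F(t₀) + 2νc·log(1−t) → −∞`: the transverse
variance `β` turns NEGATIVE before the singular time (`no_positive_transverse_variance`); and the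
`β`-equation IS forced by the adjoint equation (`transverse_variance_eq`: evaluate the PDE, divided by
the Gaussian, at `x = 0` and `x = e₁`).  Together (`no_pinched_gaussian_kernel`): a lower-pinched
linear flow `d(t) D₀x + ½ω(t) e₀×x` admits NO positive axisymmetric Gaussian `N(0, diag(α(t),β(t),β(t)))`
solving its adjoint equation on `[t₀,1)`.  Hence no linear exact-NS flow can serve as a PINCHED test
bench with an adapted Gaussian kernel: in the linear
class, lower pinching (vorticity growing at the Type-I rate, driven by a strain `d ≈ 1/(1−t)`) and the
existence of a concentrating comparable adapted kernel exclude each other — the compressing strain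
that pinches the vorticity ejects the backward particles.  A pinched bench for line
`tauberian-omega-limit` must therefore be a genuinely nonlinear, bounded-velocity flow.
-/

noncomputable section

open scoped Laplacian Topology
open Literature.Analysis.FluidPDE Set Filter MeasureTheory Real

namespace Summit.NavierStokesRegularity.NavierStokesRegularity.Theorems.AdaptedFrequencyConverges.Negative

/-- **No positive transverse variance under lower pinching.**  If `ω` obeys the stretching law
`ω′ = dω` on `[t₀,1)` and is lower-pinched, `c ≤ (1−s)ω(s)` with `0 < c`, then every solution `β`
of the transverse variance equation `β′ = −dβ − 2ν` (`ν > 0`) on `[t₀,1)` is negative somewhere on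
`[t₀,1)`: `(βω)′ = −2νω ≤ −2νc/(1−s)` forces `βω → −∞`. [folklore] -/
theorem no_positive_transverse_variance {ν c t₀ : ℝ} (hν : 0 < ν) (hc : 0 < c) (ht₀ : t₀ < 1)
    {ω d β : ℝ → ℝ} (hω : ∀ s ∈ Ico t₀ 1, HasDerivAt ω (d s * ω s) s)
    (hpinch : ∀ s ∈ Ico t₀ 1, c ≤ (1 - s) * ω s)
    (hβ : ∀ s ∈ Ico t₀ 1, HasDerivAt β (-(d s) * β s - 2 * ν) s) :
    ∃ s ∈ Ico t₀ 1, β s < 0 := by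
  -- the Lyapunov function `F = βω − 2νc log(1−s)` is non-increasing on `[t₀,1)`
  set F : ℝ → ℝ := fun s => β s * ω s - 2 * ν * c * Real.log (1 - s) with hF
  have hωpos : ∀ s ∈ Ico t₀ 1, 0 < ω s := fun s hs => by
    have h1 : 0 < 1 - s := sub_pos.2 hs.2
    have h2 := hpinch s hs
    by_contra hle
    push Not at hle
    nlinarith
  have hderiv : ∀ s ∈ Ico t₀ 1, HasDerivAt F (-2 * ν * ω s + 2 * ν * c / (1 - s)) s := by
    intro s hs
    have h1 : HasDerivAt (fun x : ℝ => 1 - x) (-1) s := (hasDerivAt_id s).const_sub 1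
    have hlog : HasDerivAt (fun x => Real.log (1 - x)) ((1 - s)⁻¹ * (-1)) s :=
      (Real.hasDerivAt_log (sub_pos.2 hs.2).ne').comp s h1
    have h2 := ((hβ s hs).mul (hω s hs)).sub (hlog.const_mul (2 * ν * c))
    refine h2.congr_deriv ?_
    field_simp
    ring
  have hderiv_nonpos : ∀ s ∈ Ico t₀ 1, -2 * ν * ω s + 2 * ν * c / (1 - s) ≤ 0 := by
    intro s hs
    have h1 : 0 < 1 - s := sub_pos.2 hs.2
    have h2 : c / (1 - s) ≤ ω s := by rw [div_le_iff₀ h1]; linarith [hpinch s hs]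
    have h3 : 2 * ν * c / (1 - s) = 2 * ν * (c / (1 - s)) := by ring
    rw [h3]
    nlinarith [mul_le_mul_of_nonneg_left h2 (by positivity : (0:ℝ) ≤ 2 * ν)]
  have hanti : AntitoneOn F (Ico t₀ 1) := by
    have hcont : ContinuousOn F (Ico t₀ 1) := fun s hs => (hderiv s hs).continuousAt.continuousWithinAt
    refine antitoneOn_of_hasDerivWithinAt_nonpos (f' := fun s => -2 * ν * ω s + 2 * ν * c / (1 - s))
      (convex_Ico t₀ 1) hcont ?_ ?_
    · intro s hs
      rw [interior_Ico] at hs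
      exact ((hderiv s (Ioo_subset_Ico_self hs)).hasDerivWithinAt)
    · intro s hs
      rw [interior_Ico] at hs
      exact hderiv_nonpos s (Ioo_subset_Ico_self hs)
  -- a late time `s` with `2νc·log(1−s) ≤ −|F t₀| − 1`
  set K : ℝ := (|F t₀| + 1) / (2 * ν * c) with hK
  have hKpos : 0 < K := by positivity
  set s : ℝ := max t₀ (1 - Real.exp (-K)) with hs
  have hs1 : s < 1 := max_lt ht₀ (by linarith [Real.exp_pos (-K)])
  have hs0 : t₀ ≤ s := le_max_left _ _
  have hsI : s ∈ Ico t₀ 1 := ⟨hs0, hs1⟩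
  have hlog : Real.log (1 - s) ≤ -K := by
    have h1 : 1 - s ≤ Real.exp (-K) := by have := le_max_right t₀ (1 - Real.exp (-K)); linarith
    have := Real.log_le_log (sub_pos.2 hs1) h1
    rwa [Real.log_exp] at this
  have hFle : F s ≤ F t₀ := hanti ⟨le_rfl, ht₀⟩ hsI hs0
  have hprod : β s * ω s < 0 := by
    have h1 : F s = β s * ω s - 2 * ν * c * Real.log (1 - s) := rfl
    have h2 : 2 * ν * c * Real.log (1 - s) ≤ 2 * ν * c * (-K) :=
      mul_le_mul_of_nonneg_left hlog (by positivity)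
    have h3 : 2 * ν * c * (-K) = -(|F t₀| + 1) := by
      rw [hK]; field_simp
    have h4 := le_abs_self (F t₀)
    linarith
  refine ⟨s, hsI, ?_⟩
  by_contra hge
  push Not at hge
  have := mul_nonneg hge (hωpos s hsI).le
  linarith

/-- **The adjoint equation forces the transverse variance equation.**  If the axisymmetric Gaussian
`gK (A r) (B r)` (variances `A, B, B`, positive at `s`) satisfies the adjoint equation of the linear flow
`linVel (d s) (ω s)` at time `s ∈ [t₀,1)` for all `x`, then `B′(s) = −d(s)B(s) − 2ν` (evaluate the
equation divided by the Gaussian at `x = 0` and `x = e₁`; the rotation `½ω e₀×x` drops out). [folklore] -/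
theorem transverse_variance_eq {ν t₀ : ℝ} {d ω A B dA dB : ℝ → ℝ} {s : ℝ} (hs : s ∈ Ico t₀ 1)
    (hA : HasDerivAt A (dA s) s) (hB : HasDerivAt B (dB s) s) (hApos : 0 < A s) (hBpos : 0 < B s)
    (hadj : ∀ x : E3, timeDerivWithin (Ico t₀ 1) (fun r y => gK (A r) (B r) y) s x
        + fderiv ℝ (gK (A s) (B s)) x (linVel (d s) (ω s) x) + ν * (Δ (gK (A s) (B s))) x = 0) :
    dB s = -(d s) * B s - 2 * ν := by
  have hbr : ∀ x : E3, gK (A s) (B s) x *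
      ( -(dA s / (2 * A s)) - dB s / B s + (x 0) ^ 2 * dA s / (2 * (A s) ^ 2)
          + ((x 1) ^ 2 + (x 2) ^ 2) * dB s / (2 * (B s) ^ 2)
        - (x 0 * (d s * x 0) / A s
            + (x 1 * (-(d s / 2) * x 1 - (ω s / 2) * x 2) + x 2 * (-(d s / 2) * x 2 + (ω s / 2) * x 1)) / B s)
        + ν * ((x 0 / A s) ^ 2 + (x 1 / B s) ^ 2 + (x 2 / B s) ^ 2 - 1 / A s - 2 / B s)) = 0 := by
    intro x
    have h := hadj x
    rw [timeDerivWithin_apply,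
      ((hasDerivAt_gK_comp hA hB hApos hBpos x).hasDerivWithinAt).derivWithin (uniqueDiffOn_Ico t₀ 1 s hs),
      fderiv_gK_apply, laplacian_gK, linVel_apply0, linVel_apply1, linVel_apply2] at h
    linear_combination h
  have hq : ∀ x : E3,
      -(dA s / (2 * A s)) - dB s / B s + (x 0) ^ 2 * dA s / (2 * (A s) ^ 2)
          + ((x 1) ^ 2 + (x 2) ^ 2) * dB s / (2 * (B s) ^ 2)
        - (x 0 * (d s * x 0) / A s
            + (x 1 * (-(d s / 2) * x 1 - (ω s / 2) * x 2) + x 2 * (-(d s / 2) * x 2 + (ω s / 2) * x 1)) / B s)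
        + ν * ((x 0 / A s) ^ 2 + (x 1 / B s) ^ 2 + (x 2 / B s) ^ 2 - 1 / A s - 2 / B s) = 0 :=
    fun x => (mul_eq_zero.1 (hbr x)).resolve_left (gK_pos hApos hBpos x).ne'
  have q0 := hq 0
  have q1 := hq (EuclideanSpace.single 1 1)
  simp only [PiLp.zero_apply, PiLp.single_apply, if_neg (show (2 : Fin 3) ≠ 1 by decide),
    if_neg (show (0 : Fin 3) ≠ 1 by decide), if_pos] at q0 q1
  norm_num at q0 q1
  have hB0 : B s ≠ 0 := hBpos.ne'
  have hA0 : A s ≠ 0 := hApos.ne'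
  have key : A s * (dB s + d s * B s + 2 * ν) = 0 := by
    field_simp at q0 q1
    linear_combination q1 - B s * q0
  have := (mul_eq_zero.1 key).resolve_left hA0
  linarith


/-- **A lower-pinched linear flow admits no adapted Gaussian kernel.**  For the linear flows
`linVel (d t) (ω t) = d(t) D₀x + ½ω(t) e₀×x` with the stretching law `ω′ = dω` on `[t₀,1)` and
LOWER-PINCHED vorticity `c ≤ (1−t)ω(t)` (`⇔` lower pinching `c² ≤ (1−t)² H` of the adapted enstrophy
`H = ω²`), there are NO positive differentiable variances `A, B` on `[t₀,1)` for which the axisymmetric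
Gaussian `gK (A t) (B t)` solves the adjoint equation `∂ₜG + u·∇G + νΔG = 0` (`ν > 0`): the hypotheses
below are contradictory.  (The cycle-1 witness `ω = amp` is not pinched — `(1−t)·amp t → 0` — and does
carry such a kernel.) [folklore] -/
theorem no_pinched_gaussian_kernel {ν c t₀ : ℝ} (hν : 0 < ν) (hc : 0 < c) (ht₀ : t₀ < 1)
    {ω d A B dA dB : ℝ → ℝ} (hω : ∀ s ∈ Ico t₀ 1, HasDerivAt ω (d s * ω s) s)
    (hpinch : ∀ s ∈ Ico t₀ 1, c ≤ (1 - s) * ω s)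
    (hA : ∀ s ∈ Ico t₀ 1, HasDerivAt A (dA s) s) (hB : ∀ s ∈ Ico t₀ 1, HasDerivAt B (dB s) s)
    (hApos : ∀ s ∈ Ico t₀ 1, 0 < A s) (hBpos : ∀ s ∈ Ico t₀ 1, 0 < B s)
    (hadj : ∀ s ∈ Ico t₀ 1, ∀ x : E3, timeDerivWithin (Ico t₀ 1) (fun r y => gK (A r) (B r) y) s x
        + fderiv ℝ (gK (A s) (B s)) x (linVel (d s) (ω s) x) + ν * (Δ (gK (A s) (B s))) x = 0) :
    False := by
  have hB' : ∀ s ∈ Ico t₀ 1, HasDerivAt B (-(d s) * B s - 2 * ν) s := fun s hs => by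
    have h := transverse_variance_eq hs (hA s hs) (hB s hs) (hApos s hs) (hBpos s hs) (hadj s hs)
    rw [← h]
    exact hB s hs
  obtain ⟨s, hs, hneg⟩ := no_positive_transverse_variance hν hc ht₀ hω hpinch hB'
  exact lt_irrefl (0:ℝ) ((hBpos s hs).trans hneg)

end Summit.NavierStokesRegularity.NavierStokesRegularity.Theorems.AdaptedFrequencyConverges.Negative

end
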